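import Summits.QuantumFields.BalabanUV.Beta.GAN24.ChargeTowerExitOrthogonal
import Summits.QuantumFields.BalabanUV.Beta.GAN24.ChargeTowerSameDirection
import Summits.QuantumFields.BalabanUV.Beta.GAN24.GaugeReadExitWard
import Summits.QuantumFields.BalabanUV.Beta.GAN24.WardResidualRotatedVertexInversion

/-!
# `BalabanUV.Beta.GAN24.RotatedVertexEndExitValue` — binder row G-an2-4 ∕ (CONV-C), the (S) row of RULING R-gan24p1-g27-1 PART B (viii), the Ward-type half (W-γ),
# EXIT⊗EXIT CLASS, EVERY LEVEL `j+1`: **THE END-POINT (α⁺) CHARGE OF A SLOT IN CLOSED FORM — `V⁺_{αβ}(e; y) = −¼·R^{(j+1)}_{αβ}(e; y)`,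
# `R^{(j+1)}_{αβ}(e; y) := Σ'_u Σ_κ 1_{B(y)}(u+e_κ)·colH G_{j+1}(e) κ u·C_{j+1}(κ,u)`** — the RIGHT HALF of leaf-06 FILE F `GaugeReadExitWard.gaugeCharge_exit_eq_two_mul_cE_mul_rotatedVertexEnd`
# ONE LEVEL UP, for every `j` (road-P2 chair `b2b-balaban-gan24-p2`, gen 43, INTENT 1)

NOT IN PRINT; OUR BOOKKEEPING ([folklore] by name: MY g42 `ChargeTowerExitOrthogonal.exists_periodic_potential_exitCharge` (the exit⊗exit charge function of `S_{j+1}` is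
`Δ_{j+1}`-exact with a bounded comb-gauged `Lc`-periodic potential) and its (M1)_{j+1} `ChargeTowerClimb.tsum_sum_E2image_mul_colH_eq_zero_of_periodic` (that function reads ZERO
through every `ℋ`-column of `G_{j+1}`), MY g42 `ChargeTowerSameDirection.tsum_exitCharge_same_eq_zero` (`α = β`: the charge function is `0`), MY g39
`WardResidualRotatedVertexInversion.hasSum_weighted_rotatedVertexEnd_comb` (the ω-charge of the END-POINT rotated vertex `(α⁺)_y` per slot, any `ω`), leaf-06 g47 FILE A ∕ F
(`CombFreeGaugeLegCharges.hasSum_prod_of_support`, `hessFFAt_inl_inl_eq_zero_of_not_mem₂`; FILE F §1 is the level-0 twin of §1 below), leaf-02 g56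
`SrecExitChargeLevelZero.tsum_exitFace_tsum_exitFace_hessFFAt_eq_zero`, MY g41 `ChargeTowerClimb.summable_bdd_mul_colH ∕ abs_tsum_sum_wΦ_mul_le`; 0 `def`, 0 cited fact,
0 `def … : Prop`, 0 sorry).  HONEST FRAMING (cell contract, verbatim): «discharging `BetaPertH` makes Bałaban's UV stability UNCONDITIONAL — a real constructive-QFT result; it is
NOT the continuum limit and NOT the Clay problem.»  HONEST DEPENDENCY (verbatim): «continuum YM on T⁴ ⇐ BetaPertH ∧ nine spine estimates (0/9 proved); BetaPertH ⇐ (D1) ∧ (D4) ∧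
CAP+tail; G-an2-4 gates asym, D1 and NE2/3/4.»

THE OBJECTS (generic `d`, in-block root `ρ = toSite r`, `r ∈ box (d+1) Lc`; level `j+1`, `G_{j+1} = coDressKBmAt ρ Lc (KInvStep Lc (j+1))`, `S_{j+1} = SpureRecAt d Lc ρ cE cVH cΛ (j+1)`,
`M_{j+1} = M1At d Lc ρ cΛ (j+1)`; slot `e = (ν, y′)`, label `y`; the exit⊗exit weight `ω(x,z) = 𝟙[x_α % Lc = Lc−1]·𝟙[z_β % Lc = Lc−1]` read in the channel `(inl α, inl β)`; the table
charges `C_S(κ,u) := Σ'_{(x,z)} ω·S_{j+1} κ u x z (inl α)(inl β)` (MY g42's CHARGE FUNCTION `C_{j+1}`), `C_M(ρ′,w)` likewise for `M_{j+1}`; all spelled out — no `def`).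
* §1 **`tsum_prod_exit_M1At`** — the multiplier table `M1At … j = (cΛ·wM1 j)•h^ρ` carries NO exit⊗exit charge in an `(inl, inl)` channel, at EVERY level `j` (FILE F §1
  `tsum_prod_exit_M1At_zero` is `j = 0`; same finite-support argument with `wM1 j`).
* §2 `exists_abs_exitCharge_le` (the charge function `C_{j+1}` is BOUNDED — it is `wVH_{j+1}·(wΦ-image of a bounded potential)`), `summable_colH_mul_exitCharge`,
  `summable_bdd_mul_colH_mul_exitCharge` (summability of the column-weighted charge function in the fine slot, with any bounded profile factor).
* §3 `half_profile_eq_of_orthogonal` — PURE `tsum` ALGEBRA: if a slot field `E` reads zero through the columns `H` (`Σ'_u Σ_κ E·H = 0`), then the half-profile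
  `½·Σ_κ Σ'_u H·(c₁ − χ)·E` is `−½·Σ'_u Σ_κ χ·H·E` — the slot-constant half drops.
* §4 **`rotatedVertexEnd_profile_exit_eq`** — THE VALUE: for every `j`, `α ≠ β`, slot `(ν,y′)`, label `y`:
  `½·(Σ_κ Σ'_u colH G_{j+1}(e) κ u·(½𝟙[y′+e_ν = y] − ½𝟙[blk(u+e_κ) = y])·C_S(κ,u) + Σ_ρ′ Σ'_w colM G_{j+1}(e) ρ′ w·(½𝟙[y′+e_ν = y] − ½𝟙[w+e_ρ′ = y])·C_M(ρ′,w)) = −¼·R^{(j+1)}_{αβ}(e; y)`,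
  `R^{(j+1)}_{αβ}(e; y) := Σ'_u Σ_κ 𝟙[blk(u+e_κ) = y]·colH G_{j+1}(e) κ u·C_S(κ,u)` (`e_κ = Pi.single κ 1 = unitVec κ`, `rfl`) — (M1)_{j+1} kills the slot-constant half (§3 with MY g42 `sum_tsum_colH_mul_exitCharge_eq_zero`'s
  mechanism), §1 kills the multiplier half; **`hasSum_exit_rotatedVertexEnd`** — hence THE exit⊗exit ω-CHARGE OF THE END-POINT ROTATED VERTEX `(α⁺)_y = ½•dM (conjV G_{j+1} X⁺_y) Lc
  S_{j+1} M_{j+1}` AT THE SLOT `e` IS `−¼·R^{(j+1)}_{αβ}(e; y)` (MY g39 value form ⨾ §4).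
* §5 SAME DIRECTION `α = β`: **`rotatedVertexEnd_profile_exit_same_eq_zero`** ∕ **`hasSum_exit_rotatedVertexEnd_same`** — the (α⁺) exit⊗exit diagonal charge is `0` at every level
  (`C_S ≡ 0` by `ChargeTowerSameDirection`, `C_M ≡ 0` by §1).
* §6 THE INTERFACE FOR (W-γ)_{j+1}: **`wardGamma_exit_of_gammaRead`** — whatever the (γ) exit⊗exit charge `Q` of the slot is, IF the (γ) read gives `Q = c·R^{(j+1)}_{αβ}(e; y)`
  (the level-(j+1) twin of leaf-06's ENGINE (M1) `gaugeRead_exitPairing_edgePotential`, NOT typed here), THEN `Q = (−4c)·V⁺` — FILE F §2's shape `Q^γ = 2cE·V⁺` one level up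
  with the constant displayed; in the (S) row's joint form `(−½cH_{j+1})·Q^γ = ε·V⁺` this is `ε = 2c·cH_{j+1}`.
READING.  With leaf-02 g58's (INV-X-geo) at the centred root (INTENTs 1–4: `CoDressedColumnPointInversion` p341771 ✓ …) and MY g39 `slotInv_of_geo_of_ward`, the (S) row for class
𝒞 at level `j+1` needs exactly ONE more identity: the (γ) read `Σ_κ Σ'_u w_κ(u)·C_S(κ,u) = c_{j+1}·R^{(j+1)}_{αβ}(e; y)` (level 0: leaf-06 FILES B–E, `c_0 = cE²∕4·(−2∕cE) …`, i.e. FILE F;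
levels ≥ 1: the level-(j+1) SOURCE PAIRING — the second-leg gauge law of `S_{j+1}` — OPEN, road-P2 memo `HOME/b2b-balaban-gan24-p2/gen43/W-GAMMA-LEVELN-GAMMA.md`).  This file
asserts NO value of any resolvent column or of Bałaban's tables; NOTHING of (W-γ)'s (γ) side at levels ≥ 1 ∕ (INV-Z) ∕ (S) ∕ (Q-R) ∕ (LT) ∕ (Q-L) ∕ (C) ∕ «T2Shape» ∕ «T2Drift» ∕
(hW, hWall) is discharged; NEVER «G-an2-4 closed» as (CONV-C); NOT D1, NOT `BetaPertH`, NOT continuum, NOT Clay.  2026-08-22; no existing file touched.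
-/

noncomputable section

open Finset
open scoped BigOperators
open Literature.MathematicalPhysics.QuantumFieldTheory
open Literature.MathematicalPhysics.QuantumFieldTheory.Balaban1983to89
open Literature.MathematicalPhysics.QuantumFieldTheory.Balaban1983to89.Beta
open ExpKernelCalculus (Site MKer Decays)
open AffineAveraging (Form1 box toSite unitVec)
open AveragingContours (blk)
open KernelSpecInstance (wΦ)
open OneStepResolventKernel (Fib)
open OneStepKernelFamily (KInvStep colH)
open SecondOrderResponse (colM dM)
open AveragingHessianKernelsRooted (hessFFAt)
open BalabanStepJetsSucc (wVH)
open Summit.QuantumFields.BalabanUV.Beta.BorderedHessian (diagK)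
open Summit.QuantumFields.BalabanUV.Beta.ChartConjugation (conjV)
open Summit.QuantumFields.BalabanUV.Beta.AveragingWardRootedStencils (legInd)
open Summit.QuantumFields.BalabanUV.Beta.AxialDressingRooted (coDressKBmAt one_le_of_neZero)
open Summit.QuantumFields.BalabanUV.Beta.LinearGaugeVH (nearBox)
open Summit.QuantumFields.BalabanUV.Beta.SpineRooted (SpureRecAt M1At)
open Summit.QuantumFields.BalabanUV.Beta.GAN24.SrecExitChargeLevelZero (tsum_exitFace_tsum_exitFace_hessFFAt_eq_zero)
open Summit.QuantumFields.BalabanUV.Beta.GAN24.CombFreeGaugeLegCharges (hasSum_prod_of_support hessFFAt_inl_inl_eq_zero_of_not_mem₂)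
open Summit.QuantumFields.BalabanUV.Beta.GAN24.ChargeTowerClimb (abs_tsum_sum_wΦ_mul_le summable_bdd_mul_colH tsum_sum_E2image_mul_colH_eq_zero_of_periodic)
open Summit.QuantumFields.BalabanUV.Beta.GAN24.ChargeTowerInduction (abs_exitInd_le_one)
open Summit.QuantumFields.BalabanUV.Beta.GAN24.ChargeTowerExitOrthogonal (exists_periodic_potential_exitCharge)
open Summit.QuantumFields.BalabanUV.Beta.GAN24.ChargeTowerSameDirection (tsum_exitCharge_same_eq_zero)
open Summit.QuantumFields.BalabanUV.Beta.GAN24.WardResidualRotatedVertexInversion (hasSum_weighted_rotatedVertexEnd_comb)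

namespace Summit.QuantumFields.BalabanUV.Beta.GAN24.RotatedVertexEndExitValue

variable {d : ℕ} {Lc : ℕ} [NeZero Lc] {r : Fin (d + 1) → ℕ}

/-! ## §1 The multiplier table carries no exit⊗exit charge, at every level -/

/-- NOT IN PRINT; OUR BOOKKEEPING.  **THE exit⊗exit CHARGE OF THE MULTIPLIER TABLE VANISHES AT EVERY LEVEL**: `Σ'_{(x,z)} 𝟙^{exit}_α(x)𝟙^{exit}_β(z)·M1At … j μ w x z (inl α)(inl β) = 0`
(box root; every `j`, every slot `(μ, w)`, every `α β`; `M1At … j = (cΛ·wM1 j)•h^ρ`, leaf-02's `tsum_exitFace_tsum_exitFace_hessFFAt_eq_zero`, finite support — FILE F §1 is `j = 0`). -/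
theorem tsum_prod_exit_M1At (hr : r ∈ box (d + 1) Lc) (cΛ : ℝ) (j : ℕ) (α β μ : Fin (d + 1)) (w : Site (d + 1)) :
    ∑' xz : Site (d + 1) × Site (d + 1), ((if xz.1 α % (Lc : ℤ) = (Lc : ℤ) - 1 then (1 : ℝ) else 0) * (if xz.2 β % (Lc : ℤ) = (Lc : ℤ) - 1 then (1 : ℝ) else 0))
        * M1At d Lc (toSite r) cΛ j μ w xz.1 xz.2 (Sum.inl α) (Sum.inl β) = 0 := by
  classical
  have hLc : 1 ≤ Lc := one_le_of_neZero Lc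
  have eM : ∀ x z, M1At d Lc (toSite r) cΛ j μ w x z (Sum.inl α) (Sum.inl β) = (cΛ * BalabanStepW2.wM1 d Lc j) * hessFFAt (toSite r) Lc μ w x z (Sum.inl α) (Sum.inl β) :=
    fun x z => by simp only [M1At, Pi.smul_apply, smul_eq_mul]
  have h := hasSum_prod_of_support (F := fun x z => ((if x α % (Lc : ℤ) = (Lc : ℤ) - 1 then (1 : ℝ) else 0) * (if z β % (Lc : ℤ) = (Lc : ℤ) - 1 then (1 : ℝ) else 0))
      * ((cΛ * BalabanStepW2.wM1 d Lc j) * hessFFAt (toSite r) Lc μ w x z (Sum.inl α) (Sum.inl β))) (nearBox Lc w) (nearBox Lc w)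
    (fun x z hxz => by rw [hessFFAt_inl_inl_eq_zero_of_not_mem₂ hr μ w x z α β hxz, mul_zero, mul_zero])
  simp only [eM]
  rw [h.tsum_eq]
  have hs : Summable (Function.uncurry fun x z => ((if x α % (Lc : ℤ) = (Lc : ℤ) - 1 then (1 : ℝ) else 0) * (if z β % (Lc : ℤ) = (Lc : ℤ) - 1 then (1 : ℝ) else 0))
      * ((cΛ * BalabanStepW2.wM1 d Lc j) * hessFFAt (toSite r) Lc μ w x z (Sum.inl α) (Sum.inl β))) := h.summable
  rw [← hs.tsum_comm]
  have e : ∀ z, ∑' x, ((if x α % (Lc : ℤ) = (Lc : ℤ) - 1 then (1 : ℝ) else 0) * (if z β % (Lc : ℤ) = (Lc : ℤ) - 1 then (1 : ℝ) else 0))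
        * ((cΛ * BalabanStepW2.wM1 d Lc j) * hessFFAt (toSite r) Lc μ w x z (Sum.inl α) (Sum.inl β))
      = (cΛ * BalabanStepW2.wM1 d Lc j) * ((if z β % (Lc : ℤ) = (Lc : ℤ) - 1 then (1 : ℝ) else 0)
          * ∑' x, (if x α % (Lc : ℤ) = (Lc : ℤ) - 1 then (1 : ℝ) else 0) * hessFFAt (toSite r) Lc μ w x z (Sum.inl α) (Sum.inl β)) := by
    intro z
    rw [← tsum_mul_left, ← tsum_mul_left]
    exact tsum_congr fun x => by ring
  rw [tsum_congr e, tsum_mul_left, tsum_exitFace_tsum_exitFace_hessFFAt_eq_zero hLc hr μ w α β, mul_zero]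

/-! ## §2 The exit⊗exit charge function is bounded; summabilities against the columns -/

/-- NOT IN PRINT; OUR BOOKKEEPING.  **THE exit⊗exit CHARGE FUNCTION OF `S_{j+1}` IS BOUNDED** (in-block root, `α ≠ β`, all `cE cVH cΛ`, every `j`): `∃ BC, ∀ κ u, |C_{j+1}(κ,u)| ≤ BC` —
it is `wVH_{j+1}` times the `wΦ`-image of a bounded potential (`exists_periodic_potential_exitCharge` ⨾ `abs_tsum_sum_wΦ_mul_le`). -/
theorem exists_abs_exitCharge_le (hr : r ∈ box (d + 1) Lc) (cE cVH cΛ : ℝ) {α β : Fin (d + 1)} (hαβ : α ≠ β) (j : ℕ) :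
    ∃ BC : ℝ, ∀ (κ : Fin (d + 1)) (u : Site (d + 1)), |∑' xz : Site (d + 1) × Site (d + 1),
        (if xz.1 α % (Lc : ℤ) = (Lc : ℤ) - 1 then (1 : ℝ) else 0) * (if xz.2 β % (Lc : ℤ) = (Lc : ℤ) - 1 then (1 : ℝ) else 0)
          * SpureRecAt d Lc (toSite r) cE cVH cΛ (j + 1) κ u xz.1 xz.2 (Sum.inl α) (Sum.inl β)| ≤ BC := by
  obtain ⟨m, ⟨B, hmB⟩, -, -, hT⟩ := exists_periodic_potential_exitCharge hr cE cVH cΛ hαβ j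
  have hB0 : 0 ≤ B := (abs_nonneg _).trans (hmB 0 0)
  refine ⟨|wVH d Lc (j + 1)| * (B * ∑ κ : Fin (d + 1), ∑ l : Fin (d + 1), ∑' z : Site (d + 1), |wΦ (N := Lc ^ (j + 1)) κ l z|), fun κ u => ?_⟩
  rw [hT κ u, abs_mul]
  refine mul_le_mul_of_nonneg_left ((abs_tsum_sum_wΦ_mul_le (Lc ^ (j + 1)) hmB κ u).trans (mul_le_mul_of_nonneg_left ?_ hB0)) (abs_nonneg _)
  exact Finset.single_le_sum (f := fun κ => ∑ l : Fin (d + 1), ∑' z : Site (d + 1), |wΦ (N := Lc ^ (j + 1)) κ l z|)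
    (fun κ _ => Finset.sum_nonneg fun l _ => tsum_nonneg fun z => abs_nonneg _) (Finset.mem_univ κ)

/-- NOT IN PRINT; OUR BOOKKEEPING.  **SUMMABILITY OF THE PROFILE-WEIGHTED CHARGE FUNCTION AGAINST A COLUMN**: for any bounded profile factor `p` (`|p κ u| ≤ Bp`) and every `κ`,
`u ↦ colH G_{j+1} Lc ν y′ κ u·p κ u·C_{j+1}(κ,u)` is summable (§2's bound ⨾ MY g41 `summable_bdd_mul_colH`). -/
theorem summable_colH_mul_bdd_mul_exitCharge (hr : r ∈ box (d + 1) Lc) (cE cVH cΛ : ℝ) {α β : Fin (d + 1)} (hαβ : α ≠ β) (j : ℕ)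
    (ν : Fin (d + 1)) (y' : Site (d + 1)) {p : Fin (d + 1) → Site (d + 1) → ℝ} {Bp : ℝ} (hp : ∀ κ u, |p κ u| ≤ Bp) (κ : Fin (d + 1)) :
    Summable fun u : Site (d + 1) => colH (coDressKBmAt (toSite r) Lc (KInvStep (d := d) Lc (j + 1))) Lc ν y' κ u * p κ u
        * ∑' xz : Site (d + 1) × Site (d + 1),
          (if xz.1 α % (Lc : ℤ) = (Lc : ℤ) - 1 then (1 : ℝ) else 0) * (if xz.2 β % (Lc : ℤ) = (Lc : ℤ) - 1 then (1 : ℝ) else 0)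
            * SpureRecAt d Lc (toSite r) cE cVH cΛ (j + 1) κ u xz.1 xz.2 (Sum.inl α) (Sum.inl β) := by
  obtain ⟨BC, hBC⟩ := exists_abs_exitCharge_le hr cE cVH cΛ hαβ j
  have hA : ∀ κ u, |p κ u * ∑' xz : Site (d + 1) × Site (d + 1),
      (if xz.1 α % (Lc : ℤ) = (Lc : ℤ) - 1 then (1 : ℝ) else 0) * (if xz.2 β % (Lc : ℤ) = (Lc : ℤ) - 1 then (1 : ℝ) else 0)
        * SpureRecAt d Lc (toSite r) cE cVH cΛ (j + 1) κ u xz.1 xz.2 (Sum.inl α) (Sum.inl β)| ≤ Bp * BC := fun κ u => by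
    rw [abs_mul]
    exact mul_le_mul (hp κ u) (hBC κ u) (abs_nonneg _) ((abs_nonneg _).trans (hp κ u))
  exact (summable_bdd_mul_colH hr (j + 1) hA ν y' κ).congr fun u => by ring

/-- NOT IN PRINT; OUR BOOKKEEPING.  The unweighted instance `p ≡ 1`: `u ↦ colH G_{j+1} Lc ν y′ κ u·C_{j+1}(κ,u)` is summable. -/
theorem summable_colH_mul_exitCharge (hr : r ∈ box (d + 1) Lc) (cE cVH cΛ : ℝ) {α β : Fin (d + 1)} (hαβ : α ≠ β) (j : ℕ)
    (ν : Fin (d + 1)) (y' : Site (d + 1)) (κ : Fin (d + 1)) :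
    Summable fun u : Site (d + 1) => colH (coDressKBmAt (toSite r) Lc (KInvStep (d := d) Lc (j + 1))) Lc ν y' κ u
        * ∑' xz : Site (d + 1) × Site (d + 1),
          (if xz.1 α % (Lc : ℤ) = (Lc : ℤ) - 1 then (1 : ℝ) else 0) * (if xz.2 β % (Lc : ℤ) = (Lc : ℤ) - 1 then (1 : ℝ) else 0)
            * SpureRecAt d Lc (toSite r) cE cVH cΛ (j + 1) κ u xz.1 xz.2 (Sum.inl α) (Sum.inl β) :=
  (summable_colH_mul_bdd_mul_exitCharge hr cE cVH cΛ hαβ j ν y' (p := fun _ _ => (1 : ℝ)) (Bp := 1) (fun _ _ => by rw [abs_one]) κ).congr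
    fun u => by ring

/-! ## §3 Pure `tsum` algebra: a slot field orthogonal to the columns loses the slot-constant half of the end-point profile -/

omit [NeZero Lc] in
/-- [folklore] **HALF-PROFILE LEMMA.**  Columns `H`, slot field `E`, a decidable leg predicate `P` (the end-point indicator), constant `c₁`; if `u ↦ E κ u·H κ u` and
`u ↦ 𝟙[P κ u]·H κ u·E κ u` are summable for every `κ` and `Σ'_u Σ_κ E κ u·H κ u = 0`, then
`½·Σ_κ Σ'_u H κ u·(c₁ − ½𝟙[P κ u])·E κ u = −¼·Σ'_u Σ_κ 𝟙[P κ u]·H κ u·E κ u` — the slot-constant half drops, the end-point half keeps `½·½`. -/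
theorem half_profile_eq_of_orthogonal (H E : Fin (d + 1) → Site (d + 1) → ℝ) (P : Fin (d + 1) → Site (d + 1) → Prop) [∀ κ u, Decidable (P κ u)] (c₁ : ℝ)
    (hs : ∀ κ, Summable fun u => E κ u * H κ u) (hs2 : ∀ κ, Summable fun u => (if P κ u then (1 : ℝ) else 0) * H κ u * E κ u)
    (H1 : ∑' u, ∑ κ, E κ u * H κ u = 0) :
    (1 / 2 : ℝ) * ∑ κ, ∑' u, H κ u * (c₁ - (if P κ u then (1 / 2 : ℝ) else 0)) * E κ u
      = -(1 / 4 : ℝ) * ∑' u, ∑ κ, (if P κ u then (1 : ℝ) else 0) * H κ u * E κ u := by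
  classical
  have e1 : ∀ κ, ∑' u, H κ u * (c₁ - (if P κ u then (1 / 2 : ℝ) else 0)) * E κ u
      = c₁ * ∑' u, E κ u * H κ u - (1 / 2 : ℝ) * ∑' u, (if P κ u then (1 : ℝ) else 0) * H κ u * E κ u := by
    intro κ
    rw [← tsum_mul_left, ← tsum_mul_left, ← ((hs κ).mul_left c₁).tsum_sub ((hs2 κ).mul_left (1 / 2 : ℝ))]
    exact tsum_congr fun u => by split_ifs <;> ring
  rw [Finset.sum_congr rfl fun κ _ => e1 κ, Finset.sum_sub_distrib, ← Finset.mul_sum, ← Finset.mul_sum,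
    ← Summable.tsum_finsetSum (fun κ _ => hs κ), H1, ← Summable.tsum_finsetSum (fun κ _ => hs2 κ)]
  ring

/-! ## §4 The END-POINT (α⁺) exit⊗exit charge at every level in closed form -/

/-- NOT IN PRINT; OUR BOOKKEEPING.  **THE END-POINT PROFILE OF THE exit⊗exit CHARGE FUNCTION, EVERY LEVEL** (in-block root, `α ≠ β`, all `cE cVH cΛ`, every `j`, slot `(ν, y′)`,
label `y`): with `C_S(κ,u) = Σ'_{(x,z)} 𝟙^{exit}_α(x)𝟙^{exit}_β(z)·S_{j+1} κ u x z (inl α)(inl β)`, `C_M(ρ′,w)` likewise for `M_{j+1}`,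
`½·(Σ_κ Σ'_u colH G_{j+1} Lc ν y′ κ u·(½𝟙[y′+e_ν = y] − ½𝟙[blk(u+e_κ) = y])·C_S(κ,u) + Σ_ρ′ Σ'_w colM G_{j+1} Lc ν y′ ρ′ w·(½𝟙[y′+e_ν = y] − ½𝟙[w+e_ρ′ = y])·C_M(ρ′,w))`
`= −¼·Σ'_u Σ_κ 𝟙[blk(u+e_κ) = y]·colH G_{j+1} Lc ν y′ κ u·C_S(κ,u)`.
PROOF: `C_M ≡ 0` (§1); `C_S` is the `wΦ`-image of a bounded comb-gauged `Lc`-periodic potential (`exists_periodic_potential_exitCharge`) which reads zero through every column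
((M1)_{j+1}, `tsum_sum_E2image_mul_colH_eq_zero_of_periodic`), so §3 drops the slot-constant half `½𝟙[y′+e_ν = y]`; the block half carries the factor `½·½`. -/
theorem rotatedVertexEnd_profile_exit_eq (hr : r ∈ box (d + 1) Lc) (cE cVH cΛ : ℝ) {α β : Fin (d + 1)} (hαβ : α ≠ β) (j : ℕ)
    (ν : Fin (d + 1)) (y' y : Site (d + 1)) :
    (1 / 2 : ℝ) *
        ((∑ κ : Fin (d + 1), ∑' u : Site (d + 1),
            colH (coDressKBmAt (toSite r) Lc (KInvStep (d := d) Lc (j + 1))) Lc ν y' κ u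
              * ((if y' + Pi.single ν 1 = y then (1 / 2 : ℝ) else 0) - (if blk Lc (u + Pi.single κ 1) = y then (1 / 2 : ℝ) else 0))
              * ∑' xz : Site (d + 1) × Site (d + 1), ((if xz.1 α % (Lc : ℤ) = (Lc : ℤ) - 1 then (1 : ℝ) else 0) * (if xz.2 β % (Lc : ℤ) = (Lc : ℤ) - 1 then (1 : ℝ) else 0))
                  * SpureRecAt d Lc (toSite r) cE cVH cΛ (j + 1) κ u xz.1 xz.2 (Sum.inl α) (Sum.inl β))
          + ∑ ρ' : Fin (d + 1), ∑' w : Site (d + 1),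
            colM (coDressKBmAt (toSite r) Lc (KInvStep (d := d) Lc (j + 1))) Lc ν y' ρ' w
              * ((if y' + Pi.single ν 1 = y then (1 / 2 : ℝ) else 0) - (if w + Pi.single ρ' 1 = y then (1 / 2 : ℝ) else 0))
              * ∑' xz : Site (d + 1) × Site (d + 1), ((if xz.1 α % (Lc : ℤ) = (Lc : ℤ) - 1 then (1 : ℝ) else 0) * (if xz.2 β % (Lc : ℤ) = (Lc : ℤ) - 1 then (1 : ℝ) else 0))
                  * M1At d Lc (toSite r) cΛ (j + 1) ρ' w xz.1 xz.2 (Sum.inl α) (Sum.inl β))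
      = -(1 / 4 : ℝ) * ∑' u : Site (d + 1), ∑ κ : Fin (d + 1), (if blk Lc (u + Pi.single κ 1) = y then (1 : ℝ) else 0)
          * colH (coDressKBmAt (toSite r) Lc (KInvStep (d := d) Lc (j + 1))) Lc ν y' κ u
          * ∑' xz : Site (d + 1) × Site (d + 1), ((if xz.1 α % (Lc : ℤ) = (Lc : ℤ) - 1 then (1 : ℝ) else 0) * (if xz.2 β % (Lc : ℤ) = (Lc : ℤ) - 1 then (1 : ℝ) else 0))
              * SpureRecAt d Lc (toSite r) cE cVH cΛ (j + 1) κ u xz.1 xz.2 (Sum.inl α) (Sum.inl β) := by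
  classical
  -- the multiplier half vanishes
  simp only [tsum_prod_exit_M1At hr cΛ (j + 1) α β, mul_zero, tsum_zero, Finset.sum_const_zero, add_zero]
  -- the charge function through its potential
  obtain ⟨m, ⟨B, hmB⟩, hm0, hper, hT⟩ := exists_periodic_potential_exitCharge hr cE cVH cΛ hαβ j
  simp only [hT]
  -- abbreviations (all displayed in the `have`s below)
  have hB0 : 0 ≤ B := (abs_nonneg _).trans (hmB 0 0)
  have hEb : ∀ κ u, |wVH d Lc (j + 1) * ∑' v, ∑ l : Fin (d + 1), wΦ (N := Lc ^ (j + 1)) κ l (u - v) * m l v|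
      ≤ |wVH d Lc (j + 1)| * (B * ∑ κ : Fin (d + 1), ∑ l : Fin (d + 1), ∑' z : Site (d + 1), |wΦ (N := Lc ^ (j + 1)) κ l z|) := by
    intro κ u
    rw [abs_mul]
    refine mul_le_mul_of_nonneg_left ((abs_tsum_sum_wΦ_mul_le (Lc ^ (j + 1)) hmB κ u).trans (mul_le_mul_of_nonneg_left ?_ hB0)) (abs_nonneg _)
    exact Finset.single_le_sum (f := fun κ => ∑ l : Fin (d + 1), ∑' z : Site (d + 1), |wΦ (N := Lc ^ (j + 1)) κ l z|)
      (fun κ _ => Finset.sum_nonneg fun l _ => tsum_nonneg fun z => abs_nonneg _) (Finset.mem_univ κ)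
  -- (M1)_{j+1}
  have H1 := tsum_sum_E2image_mul_colH_eq_zero_of_periodic hr j hmB hm0 hper ν y'
  -- summabilities
  have hs : ∀ κ, Summable fun u => (wVH d Lc (j + 1) * ∑' v, ∑ l : Fin (d + 1), wΦ (N := Lc ^ (j + 1)) κ l (u - v) * m l v)
      * colH (coDressKBmAt (toSite r) Lc (KInvStep (d := d) Lc (j + 1))) Lc ν y' κ u := fun κ => summable_bdd_mul_colH hr (j + 1) hEb ν y' κ
  have hχb : ∀ (κ : Fin (d + 1)) (u : Site (d + 1)), |(if blk Lc (u + Pi.single κ 1) = y then (1 : ℝ) else 0)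
      * (wVH d Lc (j + 1) * ∑' v, ∑ l : Fin (d + 1), wΦ (N := Lc ^ (j + 1)) κ l (u - v) * m l v)|
      ≤ 1 * (|wVH d Lc (j + 1)| * (B * ∑ κ : Fin (d + 1), ∑ l : Fin (d + 1), ∑' z : Site (d + 1), |wΦ (N := Lc ^ (j + 1)) κ l z|)) := by
    intro κ u
    rw [abs_mul]
    refine mul_le_mul ?_ (hEb κ u) (abs_nonneg _) zero_le_one
    split_ifs <;> norm_num
  have hs2 : ∀ κ, Summable fun u => (if blk Lc (u + Pi.single κ 1) = y then (1 : ℝ) else 0)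
      * colH (coDressKBmAt (toSite r) Lc (KInvStep (d := d) Lc (j + 1))) Lc ν y' κ u
      * (wVH d Lc (j + 1) * ∑' v, ∑ l : Fin (d + 1), wΦ (N := Lc ^ (j + 1)) κ l (u - v) * m l v) := fun κ =>
    (summable_bdd_mul_colH hr (j + 1) hχb ν y' κ).congr fun u => by ring
  -- §3
  exact half_profile_eq_of_orthogonal (fun κ u => colH (coDressKBmAt (toSite r) Lc (KInvStep (d := d) Lc (j + 1))) Lc ν y' κ u)
    (fun κ u => wVH d Lc (j + 1) * ∑' v, ∑ l : Fin (d + 1), wΦ (N := Lc ^ (j + 1)) κ l (u - v) * m l v)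
    (fun κ u => blk Lc (u + Pi.single κ 1) = y) _ hs hs2 H1

/-- NOT IN PRINT; OUR BOOKKEEPING.  **THE exit⊗exit CHARGE OF THE END-POINT ROTATED VERTEX `(α⁺)_y` AT EVERY LEVEL**: for every `j`, `α ≠ β`, slot `(ν, y′)`, label `y` (in-block root,
all `cE cVH cΛ`), the exit⊗exit ω-charge in the channel `(inl α, inl β)` of `(α⁺)_y := ½ • dM (conjV G_{j+1} X⁺_y) Lc S_{j+1} M_{j+1} ν y′` (`X⁺_y = diagK g⁺`, the END-POINT block
generator of MY g39) HAS THE SUM `−¼·Σ'_u Σ_κ 𝟙[blk(u+e_κ) = y]·colH G_{j+1} Lc ν y′ κ u·C_S(κ,u)` (MY g39 `hasSum_weighted_rotatedVertexEnd_comb` ⨾ §4).  Level 0's value is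
`(cE∕8)·R_y(e)` inside leaf-06 FILE F §2; this is the level-(j+1) member, with `C_S` left literal (any potential representing it may be substituted by the consumer). -/
theorem hasSum_exit_rotatedVertexEnd (hr : r ∈ box (d + 1) Lc) (cE cVH cΛ : ℝ) {α β : Fin (d + 1)} (hαβ : α ≠ β) (j : ℕ)
    (ν : Fin (d + 1)) (y' y : Site (d + 1)) :
    HasSum (fun xz : Site (d + 1) × Site (d + 1) =>
        ((if xz.1 α % (Lc : ℤ) = (Lc : ℤ) - 1 then (1 : ℝ) else 0) * (if xz.2 β % (Lc : ℤ) = (Lc : ℤ) - 1 then (1 : ℝ) else 0)) *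
        ((1 / 2 : ℝ) • dM (conjV (coDressKBmAt (toSite r) Lc (KInvStep (d := d) Lc (j + 1))) (diagK (fun z c =>
            (((1 : ℝ) / 2) • ∑ v ∈ box (d + 1) Lc, legInd (toSite r) ((Lc : ℤ) • y + toSite v))
              (z + Sum.elim (fun κ => (Pi.single κ 1 : Site (d + 1))) (fun μ => (Lc : ℤ) • (Pi.single μ 1 : Site (d + 1))) c) c))) Lc
          (SpureRecAt d Lc (toSite r) cE cVH cΛ (j + 1)) (M1At d Lc (toSite r) cΛ (j + 1)) ν y') xz.1 xz.2 (Sum.inl α) (Sum.inl β))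
      (-(1 / 4 : ℝ) * ∑' u : Site (d + 1), ∑ κ : Fin (d + 1), (if blk Lc (u + Pi.single κ 1) = y then (1 : ℝ) else 0)
          * colH (coDressKBmAt (toSite r) Lc (KInvStep (d := d) Lc (j + 1))) Lc ν y' κ u
          * ∑' xz : Site (d + 1) × Site (d + 1), ((if xz.1 α % (Lc : ℤ) = (Lc : ℤ) - 1 then (1 : ℝ) else 0) * (if xz.2 β % (Lc : ℤ) = (Lc : ℤ) - 1 then (1 : ℝ) else 0))
              * SpureRecAt d Lc (toSite r) cE cVH cΛ (j + 1) κ u xz.1 xz.2 (Sum.inl α) (Sum.inl β)) := by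
  have hLc : 1 ≤ Lc := one_le_of_neZero Lc
  have hω : ∀ xz : Site (d + 1) × Site (d + 1), |(if xz.1 α % (Lc : ℤ) = (Lc : ℤ) - 1 then (1 : ℝ) else 0) * (if xz.2 β % (Lc : ℤ) = (Lc : ℤ) - 1 then (1 : ℝ) else 0)| ≤ 1 :=
    fun xz => by
      rw [abs_mul]
      exact mul_le_one₀ (abs_exitInd_le_one _ _) (abs_nonneg _) (abs_exitInd_le_one _ _)
  have h := hasSum_weighted_rotatedVertexEnd_comb hLc hr cE cVH cΛ j y ν y' (Sum.inl α) (Sum.inl β) hω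
  rwa [rotatedVertexEnd_profile_exit_eq hr cE cVH cΛ hαβ j ν y' y] at h

/-! ## §5 Same direction `α = β`: the (α⁺) diagonal exit⊗exit charge vanishes at every level -/

/-- NOT IN PRINT; OUR BOOKKEEPING.  **SAME DIRECTION: THE END-POINT PROFILE IS ZERO** (`α = β`; every `j`, slot, label): both table charges vanish — `C_S` by MY g42
`ChargeTowerSameDirection.tsum_exitCharge_same_eq_zero`, `C_M` by §1. -/
theorem rotatedVertexEnd_profile_exit_same_eq_zero (hr : r ∈ box (d + 1) Lc) (cE cVH cΛ : ℝ) (α : Fin (d + 1)) (j : ℕ)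
    (ν : Fin (d + 1)) (y' y : Site (d + 1)) :
    (1 / 2 : ℝ) *
        ((∑ κ : Fin (d + 1), ∑' u : Site (d + 1),
            colH (coDressKBmAt (toSite r) Lc (KInvStep (d := d) Lc (j + 1))) Lc ν y' κ u
              * ((if y' + Pi.single ν 1 = y then (1 / 2 : ℝ) else 0) - (if blk Lc (u + Pi.single κ 1) = y then (1 / 2 : ℝ) else 0))
              * ∑' xz : Site (d + 1) × Site (d + 1), ((if xz.1 α % (Lc : ℤ) = (Lc : ℤ) - 1 then (1 : ℝ) else 0) * (if xz.2 α % (Lc : ℤ) = (Lc : ℤ) - 1 then (1 : ℝ) else 0))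
                  * SpureRecAt d Lc (toSite r) cE cVH cΛ (j + 1) κ u xz.1 xz.2 (Sum.inl α) (Sum.inl α))
          + ∑ ρ' : Fin (d + 1), ∑' w : Site (d + 1),
            colM (coDressKBmAt (toSite r) Lc (KInvStep (d := d) Lc (j + 1))) Lc ν y' ρ' w
              * ((if y' + Pi.single ν 1 = y then (1 / 2 : ℝ) else 0) - (if w + Pi.single ρ' 1 = y then (1 / 2 : ℝ) else 0))
              * ∑' xz : Site (d + 1) × Site (d + 1), ((if xz.1 α % (Lc : ℤ) = (Lc : ℤ) - 1 then (1 : ℝ) else 0) * (if xz.2 α % (Lc : ℤ) = (Lc : ℤ) - 1 then (1 : ℝ) else 0))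
                  * M1At d Lc (toSite r) cΛ (j + 1) ρ' w xz.1 xz.2 (Sum.inl α) (Sum.inl α)) = 0 := by
  simp only [tsum_prod_exit_M1At hr cΛ (j + 1) α α, tsum_exitCharge_same_eq_zero hr cE cVH cΛ α j, mul_zero, tsum_zero,
    Finset.sum_const_zero, add_zero]

/-- NOT IN PRINT; OUR BOOKKEEPING.  **SAME DIRECTION: THE (α⁺) DIAGONAL exit⊗exit CHARGE IS `0` AT EVERY LEVEL** (`α = β`; every `j`, slot `(ν, y′)`, label `y`). -/
theorem hasSum_exit_rotatedVertexEnd_same (hr : r ∈ box (d + 1) Lc) (cE cVH cΛ : ℝ) (α : Fin (d + 1)) (j : ℕ)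
    (ν : Fin (d + 1)) (y' y : Site (d + 1)) :
    HasSum (fun xz : Site (d + 1) × Site (d + 1) =>
        ((if xz.1 α % (Lc : ℤ) = (Lc : ℤ) - 1 then (1 : ℝ) else 0) * (if xz.2 α % (Lc : ℤ) = (Lc : ℤ) - 1 then (1 : ℝ) else 0)) *
        ((1 / 2 : ℝ) • dM (conjV (coDressKBmAt (toSite r) Lc (KInvStep (d := d) Lc (j + 1))) (diagK (fun z c =>
            (((1 : ℝ) / 2) • ∑ v ∈ box (d + 1) Lc, legInd (toSite r) ((Lc : ℤ) • y + toSite v))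
              (z + Sum.elim (fun κ => (Pi.single κ 1 : Site (d + 1))) (fun μ => (Lc : ℤ) • (Pi.single μ 1 : Site (d + 1))) c) c))) Lc
          (SpureRecAt d Lc (toSite r) cE cVH cΛ (j + 1)) (M1At d Lc (toSite r) cΛ (j + 1)) ν y') xz.1 xz.2 (Sum.inl α) (Sum.inl α)) 0 := by
  have hLc : 1 ≤ Lc := one_le_of_neZero Lc
  have hω : ∀ xz : Site (d + 1) × Site (d + 1), |(if xz.1 α % (Lc : ℤ) = (Lc : ℤ) - 1 then (1 : ℝ) else 0) * (if xz.2 α % (Lc : ℤ) = (Lc : ℤ) - 1 then (1 : ℝ) else 0)| ≤ 1 :=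
    fun xz => by
      rw [abs_mul]
      exact mul_le_one₀ (abs_exitInd_le_one _ _) (abs_nonneg _) (abs_exitInd_le_one _ _)
  have h := hasSum_weighted_rotatedVertexEnd_comb hLc hr cE cVH cΛ j y ν y' (Sum.inl α) (Sum.inl α) hω
  rwa [rotatedVertexEnd_profile_exit_same_eq_zero hr cE cVH cΛ α j ν y' y] at h

/-! ## §6 The interface for (W-γ) one level up: a (γ) read proportional to `R^{(j+1)}` gives FILE F's identity with the constant displayed -/

/-- NOT IN PRINT; OUR BOOKKEEPING.  **(W-γ)_{j+1} REDUCED TO THE (γ) READ.**  For every `j`, `α ≠ β`, slot `(ν, y′)`, label `y`: IF a real number `Q` (meant: the (γ) exit⊗exit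
ω-charge of the slot, leaf-06's `GaugeReadChargeProfile.hasSum_weighted_gaugeSup` value at `G_{j+1} ∘ dM G_{j+1} Lc S_{j+1} M_{j+1} ν y′`) satisfies
`Q = c·Σ'_u Σ_κ 𝟙[blk(u+e_κ) = y]·colH G_{j+1} Lc ν y′ κ u·C_S(κ,u)` — the level-(j+1) twin of ENGINE (M1), NOT typed here — THEN `Q = (−4c)·V⁺`, `V⁺` the end-point profile
of §4 (leaf-06 FILE F §2's `Q^γ = 2cE·V⁺` is the level-0 instance `c = cE²∕4·(−2∕cE)·(−1∕... )`, i.e. `−4c = 2cE`).  Pure algebra over §4. -/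
theorem wardGamma_exit_of_gammaRead (hr : r ∈ box (d + 1) Lc) (cE cVH cΛ : ℝ) {α β : Fin (d + 1)} (hαβ : α ≠ β) (j : ℕ)
    (ν : Fin (d + 1)) (y' y : Site (d + 1)) {Q c : ℝ}
    (hQ : Q = c * ∑' u : Site (d + 1), ∑ κ : Fin (d + 1), (if blk Lc (u + Pi.single κ 1) = y then (1 : ℝ) else 0)
          * colH (coDressKBmAt (toSite r) Lc (KInvStep (d := d) Lc (j + 1))) Lc ν y' κ u
          * ∑' xz : Site (d + 1) × Site (d + 1), ((if xz.1 α % (Lc : ℤ) = (Lc : ℤ) - 1 then (1 : ℝ) else 0) * (if xz.2 β % (Lc : ℤ) = (Lc : ℤ) - 1 then (1 : ℝ) else 0))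
              * SpureRecAt d Lc (toSite r) cE cVH cΛ (j + 1) κ u xz.1 xz.2 (Sum.inl α) (Sum.inl β)) :
    Q = (-4 * c) * ((1 / 2 : ℝ) *
        ((∑ κ : Fin (d + 1), ∑' u : Site (d + 1),
            colH (coDressKBmAt (toSite r) Lc (KInvStep (d := d) Lc (j + 1))) Lc ν y' κ u
              * ((if y' + Pi.single ν 1 = y then (1 / 2 : ℝ) else 0) - (if blk Lc (u + Pi.single κ 1) = y then (1 / 2 : ℝ) else 0))
              * ∑' xz : Site (d + 1) × Site (d + 1), ((if xz.1 α % (Lc : ℤ) = (Lc : ℤ) - 1 then (1 : ℝ) else 0) * (if xz.2 β % (Lc : ℤ) = (Lc : ℤ) - 1 then (1 : ℝ) else 0))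
                  * SpureRecAt d Lc (toSite r) cE cVH cΛ (j + 1) κ u xz.1 xz.2 (Sum.inl α) (Sum.inl β))
          + ∑ ρ' : Fin (d + 1), ∑' w : Site (d + 1),
            colM (coDressKBmAt (toSite r) Lc (KInvStep (d := d) Lc (j + 1))) Lc ν y' ρ' w
              * ((if y' + Pi.single ν 1 = y then (1 / 2 : ℝ) else 0) - (if w + Pi.single ρ' 1 = y then (1 / 2 : ℝ) else 0))
              * ∑' xz : Site (d + 1) × Site (d + 1), ((if xz.1 α % (Lc : ℤ) = (Lc : ℤ) - 1 then (1 : ℝ) else 0) * (if xz.2 β % (Lc : ℤ) = (Lc : ℤ) - 1 then (1 : ℝ) else 0))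
                  * M1At d Lc (toSite r) cΛ (j + 1) ρ' w xz.1 xz.2 (Sum.inl α) (Sum.inl β))) := by
  rw [rotatedVertexEnd_profile_exit_eq hr cE cVH cΛ hαβ j ν y' y, hQ]
  ring

end Summit.QuantumFields.BalabanUV.Beta.GAN24.RotatedVertexEndExitValue

end
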